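import Literature.NumberTheory.EllipticCurves.PAdicOneVariableMahlerMasses
import Mathlib.RingTheory.PowerSeries.Binomial
import HarnessLib

/-!
# Dilation of the distribution of a power series: `D_{H ∘ [u]} = u_* D_H` for `u ∈ ℤ_p^×`, where
# `H ∘ [u](S) = H((1+S)^u − 1)` (de Shalit 1987, I.3.2 (5)/I.3.4 Lemma (ii): "`g_{σβ} = g_β ∘ [κ(σ)]`,
# so `μ_{σβ}` is the image of `μ_β` under `x ↦ κ(σ)x`")

De Shalit 1987, I.3.4 Lemma (p. 18): "(ii) for `σ ∈ G`, `μ_{σ(β)} = σμ_β`, where `G` acts on measures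
on `ℤ_p^×` via `κ`"; II.4.5 (iv): `g_{σ_𝔠(β)} = σ_𝔠(g_β) ∘ [λ(𝔠)]^`. In the `𝔾̂_m`-coordinate `S`
(`T = θ(S)`), the endomorphism `[u]` is `S ↦ (1+S)^u − 1`, and the power series attached to `σβ` is the
DILATION `H_β((1+S)^{κ(σ)} − 1)`. This file proves that the distribution of the dilated series is the
dilated distribution:

* §1 (in `ℤ_p⟦S⟧`, `u ∈ ℤ_p` arbitrary) **`coeff_binomialSeries_sub_one_pow`**: the MAHLER COEFFICIENTS of
  `x ↦ (ux choose j)` are `Δ^k[(u· choose j)](0) = [S^j]((1+S)^u − 1)^k` (both are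
  `Σ_i (−1)^{k−i} (k choose i) (iu choose j)`), and their vanishing for `k > j`;
* §2 `binomDilate u H = Σ_k [S^k]H · ((1+S)^u − 1)^k` (coefficients bounded by the bound of `H`),
  **`integral_invAmice₁_mahlerFun₁_mul`**: `∫ (ux choose j) dD_H(x) = [S^j](H ∘ [u])`, and
  **`invAmice₁_binomDilate_μ`**: `D_{H∘[u]} = u_* D_H` levelwise (`u ∈ ℤ_p^×`), i.e.
  `D_{H∘[u]}(u b) = D_H(b)` (`invAmice₁_binomDilate_μ_unitMul`) — the `U_0`-equivariance of `β ↦ D_{H_β}`;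
* §3 linearity of `P ↦ D_P` in the masses (`invAmice₁_add_μ`, `invAmice₁_smul_μ`) — the additivity
  `μ_{ββ'} = μ_β + μ_{β'}` and the scalar `κ(σ)` of the chain rule `D(H ∘ [u]) = u · (DH) ∘ [u]`.

Everything is a definition with a body or a theorem; no named facts, no instances, no `sorry`.

## References

* [deShalit1987] E. de Shalit, *Iwasawa theory of elliptic curves with complex multiplication* (1987),
  I.3.2 (5) (p. 17), I.3.4 Lemma (p. 18), II.4.5 (iv) (p. 59).
* [Washington1997] L. C. Washington, *Introduction to Cyclotomic Fields*, GTM 83, §12.2.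
-/

noncomputable section

open Filter Topology Finset
open scoped fwdDiff

namespace Literature.NumberTheory.EllipticCurves

/-! ### §1. The Mahler coefficients of `x ↦ (ux choose j)` -/

section Binomial

variable {p : ℕ} [Fact p.Prime]

/-- `(1+S)^{mu} = ((1+S)^u)^m` in `ℤ_p⟦S⟧` for `m ∈ ℕ`. [cite: deShalit1987, I.3.2 (5) (p. 17)] -/
theorem binomialSeries_natCast_mul_padicInt (m : ℕ) (u : ℤ_[p]) :
    PowerSeries.binomialSeries ℤ_[p] ((m : ℤ_[p]) * u) = PowerSeries.binomialSeries ℤ_[p] u ^ m := by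
  induction m with
  | zero =>
    rw [Nat.cast_zero, zero_mul, pow_zero, show (0 : ℤ_[p]) = ((0 : ℕ) : ℤ_[p]) by rw [Nat.cast_zero],
      PowerSeries.binomialSeries_nat, pow_zero]
  | succ m ih => rw [Nat.cast_succ, add_mul, one_mul, PowerSeries.binomialSeries_add, ih, pow_succ]

/-- `[S^j](1+S)^w = (w choose j)`. [cite: deShalit1987, I.3.2 (5) (p. 17)] -/
theorem coeff_binomialSeries_padicInt (w : ℤ_[p]) (j : ℕ) :
    PowerSeries.coeff j (PowerSeries.binomialSeries ℤ_[p] w) = Ring.choose w j := by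
  rw [PowerSeries.binomialSeries_coeff, smul_eq_mul, mul_one]

/-- **The Mahler coefficients of `x ↦ (ux choose j)`**: `Δ^k[x ↦ (ux choose j)](0) = [S^j]((1+S)^u − 1)^k`
(both equal `Σ_i (−1)^{k−i} (k choose i) (iu choose j)`; generating function
`Σ_j (ux choose j) S^j = (1+S)^{ux} = Σ_k (x choose k)((1+S)^u − 1)^k`).
[cite: deShalit1987, I.3.2 (5) (p. 17)] [cite: Washington1997, §12.2] -/
theorem coeff_binomialSeries_sub_one_pow (u : ℤ_[p]) (k j : ℕ) :
    PowerSeries.coeff j ((PowerSeries.binomialSeries ℤ_[p] u - 1) ^ k) = Δ_[1] ^[k] (fun x : ℤ_[p] ↦ Ring.choose (u * x) j) 0 := by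
  rw [sub_eq_add_neg, add_pow, map_sum, fwdDiff_iter_eq_sum_shift]
  refine Finset.sum_congr rfl fun i _ ↦ ?_
  have hc : PowerSeries.binomialSeries ℤ_[p] u ^ i * (-1) ^ (k - i) * ((k.choose i : ℕ) : PowerSeries ℤ_[p]) =
      PowerSeries.C ((-1) ^ (k - i) * (k.choose i : ℤ_[p])) * PowerSeries.binomialSeries ℤ_[p] u ^ i := by
    rw [map_mul, map_pow, map_neg, map_one, map_natCast]; ring
  rw [hc, PowerSeries.coeff_C_mul, ← binomialSeries_natCast_mul_padicInt, coeff_binomialSeries_padicInt,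
    zsmul_eq_mul, zero_add, nsmul_eq_mul, mul_one, mul_comm u]
  push_cast
  ring

/-- `(1+S)^u − 1` is divisible by `S`. [cite: deShalit1987, I.3.2 (5) (p. 17)] -/
theorem X_dvd_binomialSeries_sub_one (u : ℤ_[p]) : (PowerSeries.X : PowerSeries ℤ_[p]) ∣ PowerSeries.binomialSeries ℤ_[p] u - 1 := by
  rw [PowerSeries.X_dvd_iff, map_sub, map_one, ← PowerSeries.coeff_zero_eq_constantCoeff_apply,
    coeff_binomialSeries_padicInt, Ring.choose_zero_right, sub_self]

/-- `[S^j]((1+S)^u − 1)^k = 0` for `j < k`. [cite: deShalit1987, I.3.2 (5) (p. 17)] -/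
theorem coeff_binomialSeries_sub_one_pow_eq_zero (u : ℤ_[p]) {k j : ℕ} (hjk : j < k) :
    PowerSeries.coeff j ((PowerSeries.binomialSeries ℤ_[p] u - 1) ^ k) = 0 := by
  obtain ⟨Q, hQ⟩ := X_dvd_binomialSeries_sub_one u
  rw [hQ, mul_pow, PowerSeries.coeff_X_pow_mul', if_neg (not_le.mpr hjk)]

/-- Hence the Mahler coefficients `Δ^k[x ↦ (ux choose j)](0)` vanish for `k > j` (a polynomial of degree
`j`). [cite: deShalit1987, I.3.2 (5) (p. 17)] -/
theorem fwdDiff_iter_choose_mul_eq_zero (u : ℤ_[p]) {k j : ℕ} (hjk : j < k) :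
    Δ_[1] ^[k] (fun x : ℤ_[p] ↦ Ring.choose (u * x) j) 0 = 0 := by
  rw [← coeff_binomialSeries_sub_one_pow, coeff_binomialSeries_sub_one_pow_eq_zero u hjk]

end Binomial

/-! ### §2. The dilated series and its distribution -/

section Dilate

variable {p : ℕ} [Fact p.Prime]
variable {𝕜 : Type*} [NormedField 𝕜] [NormedAlgebra ℚ_[p] 𝕜]

/-- **The dilation `H ∘ [u] = Σ_k [S^k]H · ((1+S)^u − 1)^k`** of `H ∈ 𝕜⟦S⟧` by `u ∈ ℤ_p` (the honest
composition `H((1+S)^u − 1)`: the inner series has no constant term, so each coefficient is a finite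
sum). [cite: deShalit1987, I.3.2 (5) (p. 17), II.4.5 (iv) (p. 59)] -/
def binomDilate (u : ℤ_[p]) (H : PowerSeries 𝕜) : PowerSeries 𝕜 :=
  PowerSeries.mk fun j ↦ ∑ k ∈ Finset.range (j + 1),
    PowerSeries.coeff k H * padicIntCast 𝕜 (PowerSeries.coeff j ((PowerSeries.binomialSeries ℤ_[p] u - 1) ^ k))

/-- The coefficients of `H ∘ [u]`. [cite: deShalit1987, I.3.2 (5) (p. 17)] -/
theorem coeff_binomDilate (u : ℤ_[p]) (H : PowerSeries 𝕜) (j : ℕ) :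
    PowerSeries.coeff j (binomDilate u H) = ∑ k ∈ Finset.range (j + 1),
      PowerSeries.coeff k H * padicIntCast 𝕜 (PowerSeries.coeff j ((PowerSeries.binomialSeries ℤ_[p] u - 1) ^ k)) := by
  rw [binomDilate, PowerSeries.coeff_mk]

variable [IsUltrametricDist 𝕜]

/-- **`H ∘ [u]` has coefficients bounded by the bound of `H`** (`(1+S)^u − 1 ∈ ℤ_p⟦S⟧`).
[cite: deShalit1987, I.3.2 (5) (p. 17)] -/
theorem norm_coeff_binomDilate_le {H : PowerSeries 𝕜} {C : ℝ} (hC : ∀ k, ‖PowerSeries.coeff k H‖ ≤ C) (u : ℤ_[p]) (j : ℕ) :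
    ‖PowerSeries.coeff j (binomDilate u H)‖ ≤ C := by
  rw [coeff_binomDilate]
  refine IsUltrametricDist.norm_sum_le_of_forall_le_of_nonneg ((norm_nonneg _).trans (hC 0))
    fun k _ ↦ ?_
  rw [norm_mul, norm_padicIntCast]
  calc ‖PowerSeries.coeff k H‖ * ‖PowerSeries.coeff j ((PowerSeries.binomialSeries ℤ_[p] u - 1) ^ k)‖ ≤ C * 1 :=
        mul_le_mul (hC k) (PadicInt.norm_le_one _) (norm_nonneg _) ((norm_nonneg _).trans (hC 0))
    _ = C := mul_one C

variable [CompleteSpace 𝕜]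

/-- **`∫ (ux choose j) dD_H(x) = [S^j](H ∘ [u])`** (Mahler integration of the polynomial
`x ↦ (ux choose j)` against `D_H`). [cite: deShalit1987, I.3.2 (5) (p. 17), I.3.3 (8) (p. 17)] -/
theorem integral_invAmice₁_mahlerFun₁_mul {H : PowerSeries 𝕜} {C : ℝ} (hC : ∀ k, ‖PowerSeries.coeff k H‖ ≤ C)
    (u : ℤ_[p]) (j : ℕ) :
    (invAmice₁ p H hC).integral (fun x ↦ mahlerFun₁ 𝕜 j (u * x)) = PowerSeries.coeff j (binomDilate u H) := by
  set f : C(ℤ_[p], ℤ_[p]) := (mahler j).comp ⟨fun x ↦ u * x, continuous_const.mul continuous_id⟩ with hfdef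
  have hf : ∀ x, (f : ℤ_[p] → ℤ_[p]) x = Ring.choose (u * x) j := fun x ↦ rfl
  have hfun : (fun x ↦ mahlerFun₁ 𝕜 j (u * x)) = fun x ↦ padicIntCast 𝕜 (f x) := by
    funext x; rw [mahlerFun₁_apply]; rfl
  have hcoe : (⇑f : ℤ_[p] → ℤ_[p]) = fun x ↦ Ring.choose (u * x) j := funext hf
  rw [hfun, integral_invAmice₁_eq_sum_of_fwdDiff_eq_zero hC f (N := j + 1) (fun k hk ↦ by
    rw [hcoe]; exact fwdDiff_iter_choose_mul_eq_zero u hk), coeff_binomDilate]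
  refine Finset.sum_congr rfl fun k _ ↦ ?_
  rw [hcoe, coeff_binomialSeries_sub_one_pow]

/-- **`D_{H ∘ [u]} = u_* D_H`** for `u ∈ ℤ_p^×`: the distribution of the dilated series is the dilated
distribution, levelwise (both have the Mahler moments `[S^j](H ∘ [u])`).
[cite: deShalit1987, I.3.4 Lemma (ii) (p. 18), II.4.5 (iv) (p. 59)] -/
theorem invAmice₁_binomDilate_μ {H : PowerSeries 𝕜} {C : ℝ} (hC : ∀ k, ‖PowerSeries.coeff k H‖ ≤ C) (u : ℤ_[p]ˣ)
    (n : ℕ) (c : ZMod (p ^ n)) :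
    (invAmice₁ p (binomDilate (u : ℤ_[p]) H) (norm_coeff_binomDilate_le hC (u : ℤ_[p]))).μ n c =
      ((invAmice₁ p H hC).mulUnit u).μ n c := by
  have h : ∀ j, (invAmice₁ p (binomDilate (u : ℤ_[p]) H) (norm_coeff_binomDilate_le hC (u : ℤ_[p]))).integral (mahlerFun₁ 𝕜 j) =
      (invAmice₁ p H hC).integral (fun x ↦ mahlerFun₁ 𝕜 j ((u : ℤ_[p]) * x)) := fun j ↦ by
    rw [integral_invAmice₁_mahlerFun₁ (norm_coeff_binomDilate_le hC (u : ℤ_[p])) j, integral_invAmice₁_mahlerFun₁_mul hC]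
  exact BoundedDistribution.μ_eq_mulUnit_μ_of_integral_mahlerFun₁_eq (invAmice₁ p H hC) u
    (invAmice₁ p (binomDilate (u : ℤ_[p]) H) (norm_coeff_binomDilate_le hC (u : ℤ_[p]))) h n c

/-- **`D_{H ∘ [u]}(u b) = D_H(b)`** — the equivariance of `β ↦ μ_β` (`μ_{σβ}(κ(σ) b) = μ_β(b)`), the
shape of the `U_0`-equivariance hypothesis of `GroupDistribution.induce`.
[cite: deShalit1987, I.3.4 Lemma (ii) (p. 18)] -/
theorem invAmice₁_binomDilate_μ_unitMul {H : PowerSeries 𝕜} {C : ℝ} (hC : ∀ k, ‖PowerSeries.coeff k H‖ ≤ C) (u : ℤ_[p]ˣ)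
    (n : ℕ) (b : ZMod (p ^ n)) :
    (invAmice₁ p (binomDilate (u : ℤ_[p]) H) (norm_coeff_binomDilate_le hC (u : ℤ_[p]))).μ n
        (BoundedDistribution.unitMul (BoundedDistribution.unitMod n u) b) =
      (invAmice₁ p H hC).μ n b := by
  have h := invAmice₁_binomDilate_μ hC u n (BoundedDistribution.unitMul (BoundedDistribution.unitMod n u) b)
  rw [BoundedDistribution.mulUnit_μ_unitMul] at h
  exact h

end Dilate

/-! ### §3. Linearity of `P ↦ D_P` in the masses -/

section Linear

variable {p : ℕ} [Fact p.Prime]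
variable {𝕜 : Type*} [NormedField 𝕜] [NormedAlgebra ℚ_[p] 𝕜] [IsUltrametricDist 𝕜] [CompleteSpace 𝕜]

/-- **Additivity `D_{P+Q} = D_P + D_Q`** levelwise (`μ_{ββ'} = μ_β + μ_{β'}`).
[cite: deShalit1987, I.3.4 Lemma (i) (p. 18), II.4.6 (p. 59)] -/
theorem invAmice₁_add_μ {P Q : PowerSeries 𝕜} {C C' C'' : ℝ} (hC : ∀ k, ‖PowerSeries.coeff k P‖ ≤ C)
    (hC' : ∀ k, ‖PowerSeries.coeff k Q‖ ≤ C') (hC'' : ∀ k, ‖PowerSeries.coeff k (P + Q)‖ ≤ C'') (n : ℕ) (a : ZMod (p ^ n)) :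
    (invAmice₁ p (P + Q) hC'').μ n a = (invAmice₁ p P hC).μ n a + (invAmice₁ p Q hC').μ n a := by
  rw [invAmice₁_μ, invAmice₁_μ, invAmice₁_μ, invAmiceMass₁, invAmiceMass₁, invAmiceMass₁,
    ← (summable_invAmiceMass₁ hC n a).tsum_add (summable_invAmiceMass₁ hC' n a)]
  exact tsum_congr fun k ↦ by rw [map_add, add_mul]

/-- **Homogeneity `D_{cP} = c D_P`** levelwise (the scalar of the chain rule `D(H∘[u]) = u·(DH)∘[u]`,
and the `12` of `μ_𝔞 = 12 δ_𝔞 μ(𝔣)`). [cite: deShalit1987, I.3.4 Lemma (i) (p. 18), II.4.12 (p. 69)] -/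
theorem invAmice₁_smul_μ {P : PowerSeries 𝕜} {C C' : ℝ} (hC : ∀ k, ‖PowerSeries.coeff k P‖ ≤ C) (c : 𝕜)
    (hC' : ∀ k, ‖PowerSeries.coeff k (c • P)‖ ≤ C') (n : ℕ) (a : ZMod (p ^ n)) :
    (invAmice₁ p (c • P) hC').μ n a = c * (invAmice₁ p P hC).μ n a := by
  rw [invAmice₁_μ, invAmice₁_μ, invAmiceMass₁, invAmiceMass₁, ← tsum_mul_left]
  exact tsum_congr fun k ↦ by rw [map_smul, smul_eq_mul, mul_assoc]

end Linear

end Literature.NumberTheory.EllipticCurves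

end
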